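import Literature.AnabelianGeometry.SemiGraphs.CommensurabilityProp25iProofs
import HarnessLib

/-!
# Finite étale coverings of `𝒢_ℍ` are SPLIT by pull-backs of finite étale coverings of `𝒢`
# — the key step of [SemiAnbd] Prop. 2.5 (i), as a standalone theorem

Mochizuki, *Semi-graphs of anabelioids*, Publ. RIMS **42** (2006) 221–322, §2, proof of Proposition 2.5 (i),
author's manuscript p. 27: "it suffices to show that any finite étale covering of `𝒢_ℍ` may be split by a
finite étale covering pulled back from `𝒢` … by our assumption of quasi-coherence, it suffices to construct,
under the further assumption that `𝒢` is of bounded order, a finite étale covering of `𝒢` each of whose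
constituent anabelioids is trivial" [cite: MochizukiSemiAnbd2006, Prop. 2.5(i) p.27].

PROOF-ONLY file (abc-iut cell, layer L3, row «DECOMP-EMB» part (FIN), seat abc-iut-L3-d1 gen 8; no
definition, no new named fact).  abc-iut-w4-d063's `piHToPi_injective` (`CommensurabilityProp25iProofs.lean`)
proves Prop. 2.5 (i) in ONE monolithic argument whose first half is exactly the printed splitting step;
this file EXTRACTS that half as a reusable theorem, for arbitrary chosen basepoints (fibre functors)
`F_v`, `F_e` of ALL the constituents of `𝒢`:

* `exists_pullback_splits_restrict` — for a quasi-coherent graph of anabelioids `𝒢`, a connected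
  sub-semi-graph `ℍ` with a vertex, and a finite étale covering `Y ∈ B(𝒢_ℍ)`, there is a finite étale
  covering `X ∈ B(𝒢)` (the pull-back of the bounded-order covering of an approximator splitting the
  kernels of the fibre actions of the constituents of `Y`) such that OVER EVERY CONSTITUENT OF `ℍ` THE
  STABILISERS OF THE POINTS OF THE FIBRE OF `X` ACT TRIVIALLY ON THE FIBRE OF `Y` ("`X|_ℍ` splits `Y`"),
  and all the fibres of `X` are nonempty.

This is the `B(𝒢)`-side form of the residual (FIN) of the tempered DECOMP chain (abc-iut-L3-d1's
`dom_of_finiteRestrictSplits`, abc-iut-w4-d052's (B), abc-iut-w5-d240's (P1)): through abc-iut's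
`toBObjObj` / `ofBObjIso` / `restrict_toAnab` it becomes «every finite covering of `𝒢_ℍ` is split by the
restriction of a finite covering of `𝒢`» in `B^cov` currency (sequel).  Code adapted from
`CommensurabilityProp25iProofs.lean` (same cell); nothing here concerns [IUTchIII] Cor. 3.12.
-/

namespace Literature.AnabelianGeometry.SemiGraphs

namespace SemiGraphOfAnabelioids

open CategoryTheory CategoryTheory.Limits CategoryTheory.PreGaloisCategory
open Literature.AnabelianGeometry.Anabelioids

universe v₁ u₁ u

variable {𝒢 : SemiGraphOfAnabelioids.{v₁, u₁, u}}

-- adapted from abc-iut-w4-d063's `piHToPi_injective` (CommensurabilityProp25iProofs.lean), first half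
/-- **Finite étale coverings of `𝒢_ℍ` are split by pull-backs of finite étale coverings of `𝒢`**
([SemiAnbd] proof of Prop. 2.5 (i), p. 27: "any finite étale covering of `𝒢_ℍ` may be split by a finite
étale covering pulled back from `𝒢`").  For `𝒢` a quasi-coherent graph of anabelioids, `ℍ` a connected
sub-semi-graph with a vertex `w`, basepoints `F_v`, `F_e` of all the constituents of `𝒢`, and
`Y ∈ B(𝒢_ℍ)`: there is `X ∈ B(𝒢)` with NONEMPTY fibres such that, over every vertex and every edge of
`ℍ`, every element of `π₁(𝒢_c, F_c)` fixing a point of the fibre of `X_c` fixes the fibre of `Y_c`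
pointwise.  (`X` = pull-back along an approximator `𝒢 → 𝒢'` splitting the kernels of the fibre actions of
the `Y_c` of the bounded-order covering of `𝒢'`.) [cite: MochizukiSemiAnbd2006, Prop. 2.5(i) p.27] -/
theorem exists_pullback_splits_restrict (hgr : 𝒢.IsGraphOfAnabelioids) (hqc : 𝒢.IsQuasiCoherent)
    (H : 𝒢.graph.Subgraph) (hHc : H.toSemiGraph.IsConnected) (w : H.toSemiGraph.Vertex)
    (F₀ : ∀ v : 𝒢.graph.Vertex, 𝒢.V v ⥤ FintypeCat.{v₁}) [hF₀ : ∀ v, FiberFunctor (F₀ v)]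
    (E₀ : ∀ e : 𝒢.graph.Edge, 𝒢.E e ⥤ FintypeCat.{v₁}) [hE₀ : ∀ e, FiberFunctor (E₀ e)]
    (Y : (𝒢.restrict H).BObj) :
    ∃ X : 𝒢.BObj,
      (∀ (vH : H.toSemiGraph.Vertex) (τ : Aut (F₀ vH.1)) (x : (F₀ vH.1).obj (X.S vH.1)),
          τ • x = x → ∀ y : (F₀ vH.1).obj (show 𝒢.V vH.1 from Y.S vH), τ • y = y) ∧
      (∀ (eH : H.toSemiGraph.Edge) (τ : Aut (E₀ eH.1)) (x : (E₀ eH.1).obj (X.T eH.1)),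
          τ • x = x → ∀ y : (E₀ eH.1).obj (show 𝒢.E eH.1 from Y.T eH), τ • y = y) ∧
      (∀ v : 𝒢.graph.Vertex, Nonempty ((F₀ v).obj (X.S v))) ∧
      (∀ e : 𝒢.graph.Edge, Nonempty ((E₀ e).obj (X.T e))) := by
  classical
  -- `B(𝒢_ℍ)` is a Galois category with basepoint `ρ_w ⋙ F₀ w`
  letI := (𝒢.restrict H).preGaloisCategory_bObj
  have hcH : (𝒢.restrict H).IsConnected := ⟨hHc⟩
  haveI : GaloisCategory (𝒢.restrict H).BObj := (𝒢.restrict H).galoisCategory_bObj hcH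
  haveI : @FiberFunctor ((𝒢.restrict H).V w) ((𝒢.restrict H).catV w)
      ((𝒢.restrict H).galV w).toPreGaloisCategory (F₀ w.1) := hF₀ w.1
  haveI : FiberFunctor ((𝒢.restrict H).ρ w ⋙ F₀ w.1) := (𝒢.restrict H).fiberFunctor_ρ hcH w (F₀ w.1)
  -- the constituents of `Y`, re-keyed as objects of the constituents of `𝒢`
  let YS : ∀ vH : H.toSemiGraph.Vertex, 𝒢.V vH.1 := fun vH => Y.S vH
  let YT : ∀ eH : H.toSemiGraph.Edge, 𝒢.E eH.1 := fun eH => Y.T eH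
  -- the fibre cardinality of `Y`, the same at every constituent of the connected `ℍ`
  let n : ℕ := Nat.card ((F₀ w.1).obj (YS w))
  have hcardV : ∀ vH : H.toSemiGraph.Vertex, Nat.card ((F₀ vH.1).obj (YS vH)) = n := by
    intro vH
    haveI : @FiberFunctor ((𝒢.restrict H).V vH) ((𝒢.restrict H).catV vH)
        ((𝒢.restrict H).galV vH).toPreGaloisCategory (F₀ vH.1) := hF₀ vH.1
    haveI : FiberFunctor ((𝒢.restrict H).ρ vH ⋙ F₀ vH.1) :=
      (𝒢.restrict H).fiberFunctor_ρ hcH vH (F₀ vH.1)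
    obtain ⟨i⟩ := nonempty_iso_of_fiberFunctor' ((𝒢.restrict H).ρ vH ⋙ F₀ vH.1)
      ((𝒢.restrict H).ρ w ⋙ F₀ w.1)
    exact card_fiber_eq_of_iso_fiberFunctor i Y
  have hcardE : ∀ eH : H.toSemiGraph.Edge, Nat.card ((E₀ eH.1).obj (YT eH)) = n := by
    intro eH
    haveI : @FiberFunctor ((𝒢.restrict H).E eH) ((𝒢.restrict H).catE eH)
        ((𝒢.restrict H).galE eH).toPreGaloisCategory (E₀ eH.1) := hE₀ eH.1
    haveI : FiberFunctor ((𝒢.restrict H).ρE eH ⋙ E₀ eH.1) :=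
      (𝒢.restrict H).fiberFunctor_ρE hcH eH (E₀ eH.1)
    obtain ⟨i⟩ := nonempty_iso_of_fiberFunctor' ((𝒢.restrict H).ρE eH ⋙ E₀ eH.1)
      ((𝒢.restrict H).ρ w ⋙ F₀ w.1)
    exact card_fiber_eq_of_iso_fiberFunctor i Y
  -- the covering collection: kernels of the fibre actions of `Y` over `ℍ`, trivial elsewhere
  have hn1 : 1 ≤ n.factorial := Nat.succ_le_of_lt (Nat.factorial_pos n)
  have hKV : ∀ v : 𝒢.graph.Vertex, ∃ K : Subgroup (Aut (F₀ v)), IsOpen (K : Set (Aut (F₀ v))) ∧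
      K.index ≤ n.factorial ∧ ∀ (hv : v ∈ H.verts) (τ : Aut (F₀ v)), τ ∈ K →
        ∀ y : (F₀ v).obj (YS ⟨v, hv⟩), τ • y = y := by
    intro v
    by_cases hv : v ∈ H.verts
    · obtain ⟨K, hKo, hKi, hKm⟩ := exists_fiberActionKernel (F₀ v) (YS ⟨v, hv⟩)
      refine ⟨K, hKo, ?_, fun _ τ hτ y => (hKm τ).mp hτ y⟩
      rw [hcardV ⟨v, hv⟩] at hKi
      exact hKi
    · refine ⟨⊤, ?_, ?_, fun hv' => absurd hv' hv⟩
      · rw [Subgroup.coe_top]; exact isOpen_univ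
      · rw [Subgroup.index_top]; exact hn1
  choose KV hKVo hKVi hKVm using hKV
  have hKE : ∀ e : 𝒢.graph.Edge, ∃ K : Subgroup (Aut (E₀ e)), IsOpen (K : Set (Aut (E₀ e))) ∧
      K.index ≤ n.factorial ∧ ∀ (he : e ∈ H.edges) (τ : Aut (E₀ e)), τ ∈ K →
        ∀ y : (E₀ e).obj (YT ⟨e, he⟩), τ • y = y := by
    intro e
    by_cases he : e ∈ H.edges
    · obtain ⟨K, hKo, hKi, hKm⟩ := exists_fiberActionKernel (E₀ e) (YT ⟨e, he⟩)
      refine ⟨K, hKo, ?_, fun _ τ hτ y => (hKm τ).mp hτ y⟩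
      rw [hcardE ⟨e, he⟩] at hKi
      exact hKi
    · refine ⟨⊤, ?_, ?_, fun he' => absurd he' he⟩
      · rw [Subgroup.coe_top]; exact isOpen_univ
      · rw [Subgroup.index_top]; exact hn1
  choose KE hKEo hKEi hKEm using hKE
  let 𝒞 : CoveringCollection 𝒢 n.factorial :=
    { FV := F₀
      fiberV := fun v => inferInstance
      FE := E₀
      fiberE := fun e => inferInstance
      UV := KV
      UE := KE
      isOpen_UV := hKVo
      isOpen_UE := hKEo
      index_UV := hKVi
      index_UE := hKEi }
  obtain ⟨𝒢', φ, happ, hsplit⟩ := hqc.exists_approximator _ hn1 𝒞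
  -- the bounded-order covering `A'` of `𝒢'` and its pull-back `X`
  obtain ⟨M', hM'1, hM'⟩ := happ.isOfBoundedOrder.exists_bound
  obtain ⟨A', hA'V, hA'E⟩ :=
    exists_boundedOrderCovering 𝒢' happ.isOfBoundedOrder.isOfInjectiveType hM'1 hM'
  have hA'E' : ∀ (e' : 𝒢'.graph.Edge) (Φ : 𝒢'.E e' ⥤ FintypeCat.{v₁}) [FiberFunctor Φ],
      (∀ (σ : Aut Φ) (x : Φ.obj (A'.T e')), σ • x = x → σ = 1) ∧ Nat.card (Φ.obj (A'.T e')) = M' := by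
    intro e' Φ _
    obtain ⟨b', v', rfl, hb'⟩ := exists_abutting_of_isApproximator hgr φ happ e'
    exact hA'E b' v' hb' Φ
  let X : 𝒢.BObj := φ.pullbackFunctor.obj A'
  -- fibres of `X`: free modulo the kernel of the approximator, of cardinality `M' ≥ 1`
  have hXV : ∀ (v : 𝒢.graph.Vertex) (τ : Aut (F₀ v)) (x : (F₀ v).obj (X.S v)), τ • x = x →
      pi1Map (φ.φV v).pullback (F₀ v) τ = 1 := by
    intro v τ x hx
    haveI : PreservesFiniteLimits (φ.φV v).pullback := (φ.φV v).property.1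
    haveI : PreservesFiniteColimits (φ.φV v).pullback := (φ.φV v).property.2
    haveI : FiberFunctor ((φ.φV v).pullback ⋙ F₀ v) := fiberFunctor_comp_of_exact _ _
    exact (hA'V (φ.base.vertexMap v) ((φ.φV v).pullback ⋙ F₀ v)).1 (pi1Map (φ.φV v).pullback (F₀ v) τ)
      x hx
  have hXE : ∀ (e : 𝒢.graph.Edge) (τ : Aut (E₀ e)) (x : (E₀ e).obj (X.T e)), τ • x = x →
      pi1Map (φ.φE e (φ.base.edgeMap e) rfl).pullback (E₀ e) τ = 1 := by
    intro e τ x hx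
    haveI : PreservesFiniteLimits (φ.φE e (φ.base.edgeMap e) rfl).pullback :=
      (φ.φE e (φ.base.edgeMap e) rfl).property.1
    haveI : PreservesFiniteColimits (φ.φE e (φ.base.edgeMap e) rfl).pullback :=
      (φ.φE e (φ.base.edgeMap e) rfl).property.2
    haveI : FiberFunctor ((φ.φE e (φ.base.edgeMap e) rfl).pullback ⋙ E₀ e) :=
      fiberFunctor_comp_of_exact _ _
    exact (hA'E' (φ.base.edgeMap e) ((φ.φE e (φ.base.edgeMap e) rfl).pullback ⋙ E₀ e)).1
      (pi1Map _ (E₀ e) τ) x hx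
  have hXVne : ∀ v : 𝒢.graph.Vertex, Nonempty ((F₀ v).obj (X.S v)) := by
    intro v
    haveI : PreservesFiniteLimits (φ.φV v).pullback := (φ.φV v).property.1
    haveI : PreservesFiniteColimits (φ.φV v).pullback := (φ.φV v).property.2
    haveI : FiberFunctor ((φ.φV v).pullback ⋙ F₀ v) := fiberFunctor_comp_of_exact _ _
    have hc : Nat.card ((F₀ v).obj (X.S v)) = M' :=
      (hA'V (φ.base.vertexMap v) ((φ.φV v).pullback ⋙ F₀ v)).2
    have hpos : 0 < Nat.card ((F₀ v).obj (X.S v)) := by rw [hc]; exact hM'1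
    exact (Nat.card_pos_iff.mp hpos).1
  have hXEne : ∀ e : 𝒢.graph.Edge, Nonempty ((E₀ e).obj (X.T e)) := by
    intro e
    haveI : PreservesFiniteLimits (φ.φE e (φ.base.edgeMap e) rfl).pullback :=
      (φ.φE e (φ.base.edgeMap e) rfl).property.1
    haveI : PreservesFiniteColimits (φ.φE e (φ.base.edgeMap e) rfl).pullback :=
      (φ.φE e (φ.base.edgeMap e) rfl).property.2
    haveI : FiberFunctor ((φ.φE e (φ.base.edgeMap e) rfl).pullback ⋙ E₀ e) :=
      fiberFunctor_comp_of_exact _ _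
    have hc : Nat.card ((E₀ e).obj (X.T e)) = M' :=
      (hA'E' (φ.base.edgeMap e) ((φ.φE e (φ.base.edgeMap e) rfl).pullback ⋙ E₀ e)).2
    have hpos : 0 < Nat.card ((E₀ e).obj (X.T e)) := by rw [hc]; exact hM'1
    exact (Nat.card_pos_iff.mp hpos).1
  -- "`X` splits `Y`" over the constituents of `ℍ`
  refine ⟨X, fun vH τ x hx y => ?_, fun eH τ x hx y => ?_, hXVne, hXEne⟩
  · have h2 : τ ∈ KV vH.1 := hsplit.1 vH.1 ((MonoidHom.mem_ker).mpr (hXV vH.1 τ x hx))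
    exact hKVm vH.1 vH.2 τ h2 y
  · have h2 : τ ∈ KE eH.1 := hsplit.2 eH.1 ((MonoidHom.mem_ker).mpr (hXE eH.1 τ x hx))
    exact hKEm eH.1 eH.2 τ h2 y

end SemiGraphOfAnabelioids

end Literature.AnabelianGeometry.SemiGraphs
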